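import Literature.MathematicalPhysics.QuantumFieldTheory.StrongCouplingPolymerSystem
import Literature.MathematicalPhysics.QuantumFieldTheory.StrongCouplingReplica
import HarnessLib

/-!
# The replica expansion of truncated correlations for a general plaquette system

Support for the uniform clustering of the torus Wilson states at strong coupling
(`UniformTorusClustering`; Osterwalder–Seiler, Ann. Phys. 110 (1978) 440, Thm. 3.5 with
Remark (3.9), periodic rendering). `StrongCouplingReplica` develops the replica (doubling) trick
for the genuine plaquettes of `ℤ^d` with the normalised activities; this file redoes its
volume-independent core for an **abstract plaquette system** `S : PlaqSystem d G ι`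
(`StrongCouplingPolymerSystem`: labels with finite bond sets in `ZdEdge d`, costs depending on
the bond variables, weights `f_p = exp(-β s_p) - 1`), with the UNnormalised weights and complex
coupling — the two instances being the free theory and the torus system
(`StrongCouplingTorusSystem.torusSystem`). Everything is proved.

* complex-valued integrals on the doubled Haar product `dblHaar` (`integral_comp_fst_dblHaarC`,
  `integral_comp_swapOnC`, independence of the replicas `integral_fst_mul_snd_dblHaarC`);
* the doubled weights `S.dblWeight β p (U, U') = (1 + f_p(U))(1 + f_p(U')) - 1`, their products
  `S.dblWeightProd`, the expansion `∏(1+f_p(U)) ∏(1+f_p(U')) = ∑_{Q ⊆ V} ∏_{p ∈ Q} g_p`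
  (`prod_mul_prod_eq_sum_dblWeightProd`), bounds `‖g_Q‖ ≤ (8M‖β‖)^{|Q|}` and locality;
* the label-level notion of a polymer **joining** two bond sets (`S.Joins Q B₁ B₂`: a label of
  `Q` touching `B₁` reaches, inside `Q`, a label of `Q` touching `B₂`), the swap region
  `S.joinedRegion Q B₁`, and the **vanishing of the non-joining terms**
  (`integral_trunc_dblWeightProd_eq_zero`: swap the replicas on the joined region);
The replica formula itself and its expansion over joining polymers are in the sequel
`PlaqSystemReplicaFormula`.

## References

* K. Osterwalder, E. Seiler, Ann. Phys. 110 (1978) 440–471, §3 [OsterwalderSeilerAnnPhys1978].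
* E. Seiler, LNP 159 (1982), Ch. 2–3 [SeilerLNP1982].
-/

namespace Literature.MathematicalPhysics.QuantumFieldTheory

open MeasureTheory Measure ProbabilityTheory Finset Filter
open scoped Topology

noncomputable section

/-! ### Complex-valued integrals on the doubled Haar product -/

section DblMeasure

variable {d : ℕ} {G : Type*} [Group G] [TopologicalSpace G] [IsTopologicalGroup G]
  [CompactSpace G] [MeasurableSpace G] [BorelSpace G]

/-- Integrals of (vector-valued) functions of the first replica. [folklore] -/
theorem integral_comp_fst_dblHaarC {E : Type*} [NormedAddCommGroup E] [NormedSpace ℝ E]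
    {F : ZdGaugeConfig d G → E} (hF : AEStronglyMeasurable F (zdHaar d G)) :
    ∫ W, F W.fst ∂dblHaar d G = ∫ U, F U ∂zdHaar d G := by
  rw [← map_fst_dblHaar, integral_map DblConfig.measurable_fst.aemeasurable]
  rwa [map_fst_dblHaar]

/-- Integrals of (vector-valued) functions of the second replica. [folklore] -/
theorem integral_comp_snd_dblHaarC {E : Type*} [NormedAddCommGroup E] [NormedSpace ℝ E]
    {F : ZdGaugeConfig d G → E} (hF : AEStronglyMeasurable F (zdHaar d G)) :
    ∫ W, F W.snd ∂dblHaar d G = ∫ U, F U ∂zdHaar d G := by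
  rw [← map_snd_dblHaar, integral_map DblConfig.measurable_snd.aemeasurable]
  rwa [map_snd_dblHaar]

/-- The local swap preserves the doubled Haar product: integrals of vector-valued functions are
invariant. [folklore] -/
theorem integral_comp_swapOnC (L : Set (ZdEdge d)) [DecidablePred (· ∈ L)] {E : Type*}
    [NormedAddCommGroup E] [NormedSpace ℝ E] {Φ : DblConfig d G → E}
    (hΦ : AEStronglyMeasurable Φ (dblHaar d G)) :
    ∫ W, Φ (W.swapOn L) ∂dblHaar d G = ∫ W, Φ W ∂dblHaar d G := by
  have hm : Measurable fun (W : DblConfig d G) => W.swapOn L :=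
    measurable_pi_lambda _ fun e => measurable_pi_apply _
  have hmap : (dblHaar d G).map (fun W : DblConfig d G => W.swapOn L) = dblHaar d G :=
    Literature.Probability.LatticeModels.map_reindex_infinitePi (haarProbability G) (swapEquiv L)
  rw [← integral_map hm.aemeasurable (by rwa [hmap]), hmap]

/-- **Independence of bond-disjoint observables** for the Haar product over an arbitrary bond
type (complex-valued; the proof of `integral_mul_of_dependsOn` verbatim). [folklore] -/
theorem integral_mul_of_dependsOn_haarPi {κ : Type*} {S T : Finset κ} (hST : Disjoint S T)
    {g h : (κ → G) → ℂ} (hg : Measurable g) (hh : Measurable h)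
    (hgS : DependsOn g (S : Set κ)) (hhT : DependsOn h (T : Set κ)) :
    ∫ U, g U * h U ∂(infinitePi fun _ : κ => haarProbability G) =
      (∫ U, g U ∂(infinitePi fun _ : κ => haarProbability G)) *
        ∫ U, h U ∂(infinitePi fun _ : κ => haarProbability G) := by
  classical
  set ν : Measure (κ → G) := infinitePi fun _ : κ => haarProbability G with hν
  set extS : (S → G) → (κ → G) := fun v e => if he : e ∈ S then v ⟨e, he⟩ else 1 with hextS
  set extT : (T → G) → (κ → G) := fun v e => if he : e ∈ T then v ⟨e, he⟩ else 1 with hextT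
  have mext : ∀ (R : Finset κ), Measurable (fun (v : R → G) (e : κ) =>
      if he : e ∈ R then v ⟨e, he⟩ else (1 : G)) := by
    intro R
    refine measurable_pi_lambda _ fun e => ?_
    by_cases he : e ∈ R
    · simp only [he, dif_pos]; exact measurable_pi_apply _
    · simp only [he, dif_neg, not_false_eq_true]; exact measurable_const
  set gS : (S → G) → ℂ := g ∘ extS with hgS_def
  set hT : (T → G) → ℂ := h ∘ extT with hhT_def
  have hgext : ∀ U, g U = gS (fun i : S => U i) := by
    intro U
    simp only [hgS_def, Function.comp]
    refine hgS fun i hi => ?_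
    simp [hextS, Finset.mem_coe.1 hi]
  have hhext : ∀ U, h U = hT (fun i : T => U i) := by
    intro U
    simp only [hhT_def, Function.comp]
    refine hhT fun i hi => ?_
    simp [hextT, Finset.mem_coe.1 hi]
  have hind : IndepFun (fun (U : κ → G) (i : S) => U i) (fun (U : κ → G) (i : T) => U i) ν := by
    have hi := iIndepFun_infinitePi (P := fun _ : κ => haarProbability G)
      (X := fun (_ : κ) (ω : G) => ω) (fun _ => measurable_id)
    exact hi.indepFun_finset S T hST (fun i => measurable_pi_apply i)
  have mgS : Measurable gS := hg.comp (mext S)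
  have mhT : Measurable hT := hh.comp (mext T)
  calc ∫ U, g U * h U ∂ν
      = ∫ U, gS (fun i : S => U i) * hT (fun i : T => U i) ∂ν :=
        integral_congr_ae (Eventually.of_forall fun U => by
          show g U * h U = gS (fun i : S => U i) * hT (fun i : T => U i)
          rw [hgext U, hhext U])
    _ = (∫ U, gS (fun i : S => U i) ∂ν) * ∫ U, hT (fun i : T => U i) ∂ν :=
        hind.integral_fun_comp_mul_comp
          (measurable_pi_lambda _ fun i => measurable_pi_apply _).aemeasurable
          (measurable_pi_lambda _ fun i => measurable_pi_apply _).aemeasurable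
          mgS.aestronglyMeasurable mhT.aestronglyMeasurable
    _ = (∫ U, g U ∂ν) * ∫ U, h U ∂ν := by
        congr 1
        · exact integral_congr_ae (Eventually.of_forall fun U => (hgext U).symm)
        · exact integral_congr_ae (Eventually.of_forall fun U => (hhext U).symm)

/-- **Independence of the two replicas** (complex-valued, bond-local observables):
`∫ A(U) B(U') = ∫ A · ∫ B`. [folklore] -/
theorem integral_fst_mul_snd_dblHaarC {A B : ZdGaugeConfig d G → ℂ} (hAm : Measurable A)
    (hBm : Measurable B) {EA EB : Finset (ZdEdge d)} (hA : DependsOn A (EA : Set (ZdEdge d)))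
    (hB : DependsOn B (EB : Set (ZdEdge d))) :
    ∫ W, A W.fst * B W.snd ∂dblHaar d G = (∫ U, A U ∂zdHaar d G) * ∫ U, B U ∂zdHaar d G := by
  classical
  have h := integral_mul_of_dependsOn_haarPi (G := G)
    (S := EA ×ˢ ({false} : Finset Bool)) (T := EB ×ˢ ({true} : Finset Bool))
    (g := fun W : DblConfig d G => A W.fst) (h := fun W : DblConfig d G => B W.snd)
    (by
      rw [Finset.disjoint_left]
      rintro ⟨e, b⟩ h1 h2
      simp only [Finset.mem_product, Finset.mem_singleton] at h1 h2
      exact Bool.false_ne_true (h1.2.symm.trans h2.2))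
    (hAm.comp DblConfig.measurable_fst) (hBm.comp DblConfig.measurable_snd)
    (DblConfig.dependsOn_comp_fst hA) (DblConfig.dependsOn_comp_snd hB)
  rw [dblHaar, h, ← dblHaar, integral_comp_fst_dblHaarC hAm.aestronglyMeasurable,
    integral_comp_snd_dblHaarC hBm.aestronglyMeasurable]

end DblMeasure

namespace PlaqSystem

variable {d : ℕ} {G : Type*} {ι : Type*} (S : PlaqSystem d G ι)

/-! ### Doubled weights -/

/-- The **doubled weight** `g_p(U, U') = (1 + f_p(U))(1 + f_p(U')) - 1` of the replica expansion
`w(U) w(U') = ∏_p (1 + g_p)`. [folklore] -/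
def dblWeight (β : ℂ) (p : ι) (W : DblConfig d G) : ℂ :=
  (1 + S.weight β p W.fst) * (1 + S.weight β p W.snd) - 1

/-- The product of doubled weights over a label set, `g_Q = ∏_{p ∈ Q} g_p`. [folklore] -/
def dblWeightProd (β : ℂ) (Q : Finset ι) (W : DblConfig d G) : ℂ := ∏ p ∈ Q, S.dblWeight β p W

/-- **The replica expansion**: `∏_{p ∈ V} (1 + f_p(U)) · ∏_{p ∈ V} (1 + f_p(U')) = ∑_{Q ⊆ V} g_Q`.
[folklore] -/
theorem prod_mul_prod_eq_sum_dblWeightProd (β : ℂ) (V : Finset ι) (W : DblConfig d G) :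
    (∏ p ∈ V, (1 + S.weight β p W.fst)) * ∏ p ∈ V, (1 + S.weight β p W.snd) =
      ∑ Q ∈ V.powerset, S.dblWeightProd β Q W := by
  rw [← Finset.prod_mul_distrib]
  have h : ∀ p, (1 + S.weight β p W.fst) * (1 + S.weight β p W.snd) = 1 + S.dblWeight β p W :=
    fun p => by simp [dblWeight]
  simp_rw [h, Finset.prod_one_add]
  rfl

/-- The doubled weight depends only on the doubled bonds of its label. [folklore] -/
theorem dependsOn_dblWeight (β : ℂ) (p : ι) :
    DependsOn (S.dblWeight β p) {e : DblEdge d | e.1 ∈ S.bonds p} := by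
  intro W W' h
  have h1 : S.weight β p (DblConfig.fst W) = S.weight β p (DblConfig.fst W') :=
    S.dependsOn_weight β p (fun e he => h (e, false) (by simpa using he))
  have h2 : S.weight β p (DblConfig.snd W) = S.weight β p (DblConfig.snd W') :=
    S.dependsOn_weight β p (fun e he => h (e, true) (by simpa using he))
  unfold dblWeight
  rw [h1, h2]

/-- Products of doubled weights depend only on the doubled bonds of their labels. [folklore] -/
theorem dependsOn_dblWeightProd (β : ℂ) (Q : Finset ι) :
    DependsOn (S.dblWeightProd β Q) {e : DblEdge d | ∃ p ∈ Q, e.1 ∈ S.bonds p} := by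
  intro W W' h
  unfold dblWeightProd
  exact Finset.prod_congr rfl fun p hp => S.dependsOn_dblWeight β p fun e he => h e ⟨p, hp, he⟩

/-- The doubled weight of a label with all bonds in `L` is swap invariant (its two factors are
exchanged). [folklore] -/
theorem dblWeight_swapOn_of_subset (L : Set (ZdEdge d)) [DecidablePred (· ∈ L)] (β : ℂ) {p : ι}
    (hp : ((S.bonds p : Finset (ZdEdge d)) : Set (ZdEdge d)) ⊆ L) (W : DblConfig d G) :
    S.dblWeight β p (W.swapOn L) = S.dblWeight β p W := by
  unfold dblWeight
  rw [DblConfig.apply_fst_swapOn_of_subset L (S.dependsOn_weight β p) hp,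
    DblConfig.apply_snd_swapOn_of_subset L (S.dependsOn_weight β p) hp, mul_comm]

/-- The doubled weight of a label with no bond in `L` is swap invariant. [folklore] -/
theorem dblWeight_swapOn_of_disjoint (L : Set (ZdEdge d)) [DecidablePred (· ∈ L)] (β : ℂ) {p : ι}
    (hp : Disjoint ((S.bonds p : Finset (ZdEdge d)) : Set (ZdEdge d)) L) (W : DblConfig d G) :
    S.dblWeight β p (W.swapOn L) = S.dblWeight β p W := by
  unfold dblWeight
  rw [DblConfig.apply_fst_swapOn_of_disjoint L (S.dependsOn_weight β p) hp,
    DblConfig.apply_snd_swapOn_of_disjoint L (S.dependsOn_weight β p) hp]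

section Bounds

variable {S} [MeasurableSpace G] {M : ℝ} {D : ℕ}

/-- `‖g_p‖ ≤ 8 M ‖β‖` at strong coupling `‖β‖ M ≤ 1` (`g = f + f' + f f'`, `‖f‖ ≤ 2M‖β‖ ≤ 2`).
[folklore] -/
theorem norm_dblWeight_le (hR : S.Regular M D) {β : ℂ} (hβ : ‖β‖ * M ≤ 1) (p : ι)
    (W : DblConfig d G) : ‖S.dblWeight β p W‖ ≤ 8 * M * ‖β‖ := by
  have h1 := norm_weight_le hR hβ p W.fst
  have h2 := norm_weight_le hR hβ p W.snd
  have hM := hR.pos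
  have h3 : 2 * M * ‖β‖ ≤ 2 := by nlinarith [norm_nonneg β]
  have e : S.dblWeight β p W =
      S.weight β p W.fst + S.weight β p W.snd + S.weight β p W.fst * S.weight β p W.snd := by
    unfold dblWeight; ring
  rw [e]
  calc ‖S.weight β p W.fst + S.weight β p W.snd + S.weight β p W.fst * S.weight β p W.snd‖
      ≤ ‖S.weight β p W.fst‖ + ‖S.weight β p W.snd‖ +
          ‖S.weight β p W.fst‖ * ‖S.weight β p W.snd‖ := by
        refine (norm_add_le _ _).trans (add_le_add (norm_add_le _ _) ?_)
        rw [norm_mul]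
    _ ≤ 2 * M * ‖β‖ + 2 * M * ‖β‖ + 2 * M * ‖β‖ * 2 := by
        gcongr
        exact h2.trans h3
    _ = 8 * M * ‖β‖ := by ring

/-- `‖g_Q‖ ≤ (8 M ‖β‖)^{|Q|}`. [folklore] -/
theorem norm_dblWeightProd_le (hR : S.Regular M D) {β : ℂ} (hβ : ‖β‖ * M ≤ 1) (Q : Finset ι)
    (W : DblConfig d G) : ‖S.dblWeightProd β Q W‖ ≤ (8 * M * ‖β‖) ^ Q.card := by
  unfold dblWeightProd
  refine (Finset.norm_prod_le _ _).trans ?_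
  rw [← Finset.prod_const]
  exact Finset.prod_le_prod (fun _ _ => norm_nonneg _) fun p _ => norm_dblWeight_le hR hβ p W

/-- Measurability of the doubled weights. [folklore] -/
theorem measurable_dblWeight (hR : S.Regular M D) (β : ℂ) (p : ι) :
    Measurable (S.dblWeight β p : DblConfig d G → ℂ) := by
  unfold dblWeight
  exact ((((measurable_weight hR β p).comp DblConfig.measurable_fst).const_add 1).mul
    (((measurable_weight hR β p).comp DblConfig.measurable_snd).const_add 1)).sub_const 1

/-- Measurability of products of doubled weights. [folklore] -/
theorem measurable_dblWeightProd (hR : S.Regular M D) (β : ℂ) (Q : Finset ι) :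
    Measurable (S.dblWeightProd β Q : DblConfig d G → ℂ) :=
  Finset.measurable_prod _ fun p _ => measurable_dblWeight hR β p

end Bounds

/-! ### Joining polymers and the swap region -/

section Join

/-- **`Q` joins `B₁` to `B₂`**: a label of `Q` touching `B₁` is connected, inside `Q` (chains of
labels sharing bonds), to a label of `Q` touching `B₂`. [folklore] -/
def Joins (Q : Finset ι) (B₁ B₂ : Finset (ZdEdge d)) : Prop :=
  ∃ p ∈ Q, ∃ q ∈ Q, S.Touches B₁ p ∧ S.Touches B₂ q ∧ Polymer.Reach S.Adj Q p q

/-- The **swap region**: the bonds of `B₁` together with the bonds of the labels of `Q` reachable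
inside `Q` from a label of `Q` touching `B₁`. [folklore] -/
def joinedRegion (Q : Finset ι) (B₁ : Finset (ZdEdge d)) : Set (ZdEdge d) :=
  (B₁ : Set (ZdEdge d)) ∪
    {ℓ | ∃ p ∈ Q, ∃ q ∈ Q, S.Touches B₁ p ∧ Polymer.Reach S.Adj Q p q ∧ ℓ ∈ S.bonds q}

/-- `B₁` lies in the swap region. [folklore] -/
theorem subset_joinedRegion (Q : Finset ι) (B₁ : Finset (ZdEdge d)) :
    (B₁ : Set (ZdEdge d)) ⊆ S.joinedRegion Q B₁ := Set.subset_union_left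

/-- **All or nothing**: a label of `Q` has all of its bonds in the swap region, or none. [folklore] -/
theorem bonds_subset_or_disjoint_joinedRegion (Q : Finset ι) (B₁ : Finset (ZdEdge d)) {p : ι}
    (hp : p ∈ Q) :
    ((S.bonds p : Finset (ZdEdge d)) : Set (ZdEdge d)) ⊆ S.joinedRegion Q B₁ ∨
      Disjoint ((S.bonds p : Finset (ZdEdge d)) : Set (ZdEdge d)) (S.joinedRegion Q B₁) := by
  by_cases hreach : ∃ p₀ ∈ Q, S.Touches B₁ p₀ ∧ Polymer.Reach S.Adj Q p₀ p
  · obtain ⟨p₀, hp₀, ht, hr⟩ := hreach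
    exact Or.inl fun ℓ hℓ => Or.inr ⟨p₀, hp₀, p, hp, ht, hr, hℓ⟩
  · push Not at hreach
    refine Or.inr (Set.disjoint_left.2 fun ℓ hℓ hj => ?_)
    rcases hj with hB | ⟨p₀, hp₀, q, hq, ht, hr, hℓq⟩
    · -- `p` touches `B₁`, hence is reachable from itself
      exact hreach p hp (Finset.not_disjoint_iff.2 ⟨ℓ, hℓ, hB⟩) (Polymer.Reach.refl p)
    · -- `p` shares the bond `ℓ` with the reachable `q`
      exact hreach p₀ hp₀ ht (hr.tail hq hp ((S.adj_iff).2 ⟨ℓ, hℓq, hℓ⟩))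

/-- If `Q` does not join `B₁` to `B₂` (and the supports are disjoint), `B₂` avoids the swap
region. [folklore] -/
theorem disjoint_joinedRegion {Q : Finset ι} {B₁ B₂ : Finset (ZdEdge d)} (hJ : ¬ S.Joins Q B₁ B₂)
    (hB : Disjoint B₁ B₂) : Disjoint (B₂ : Set (ZdEdge d)) (S.joinedRegion Q B₁) := by
  refine Set.disjoint_left.2 fun ℓ hℓ hj => ?_
  rcases hj with hB₁ | ⟨p₀, hp₀, q, hq, ht, hr, hℓq⟩
  · exact Finset.disjoint_left.1 hB hB₁ hℓ
  · exact hJ ⟨p₀, hp₀, q, hq, ht, Finset.not_disjoint_iff.2 ⟨ℓ, hℓq, hℓ⟩, hr⟩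

variable [Group G] [TopologicalSpace G] [IsTopologicalGroup G] [CompactSpace G]
  [MeasurableSpace G] [BorelSpace G]

/-- **Vanishing of the non-joining terms** (local swap symmetry): if `F₁` depends on `B₁`, `F₂` on
`B₂`, `B₁ ∩ B₂ = ∅` and `Q` does not join `B₁` to `B₂`, then
`∫ (F₁(U) - F₁(U')) (F₂(U) - F₂(U')) g_Q(U, U') = 0`. [folklore] -/
theorem integral_trunc_dblWeightProd_eq_zero (β : ℂ) {Q : Finset ι} {B₁ B₂ : Finset (ZdEdge d)}
    {F₁ F₂ : ZdGaugeConfig d G → ℂ} (hF₁ : DependsOn F₁ (B₁ : Set (ZdEdge d)))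
    (hF₂ : DependsOn F₂ (B₂ : Set (ZdEdge d)))
    (hΦ : AEStronglyMeasurable (fun W : DblConfig d G =>
      (F₁ W.fst - F₁ W.snd) * (F₂ W.fst - F₂ W.snd) * S.dblWeightProd β Q W) (dblHaar d G))
    (hJ : ¬ S.Joins Q B₁ B₂) (hB : Disjoint B₁ B₂) :
    ∫ W, (F₁ W.fst - F₁ W.snd) * (F₂ W.fst - F₂ W.snd) * S.dblWeightProd β Q W ∂dblHaar d G = 0 := by
  classical
  set L := S.joinedRegion Q B₁ with hL
  set Φ : DblConfig d G → ℂ := fun W =>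
    (F₁ W.fst - F₁ W.snd) * (F₂ W.fst - F₂ W.snd) * S.dblWeightProd β Q W with hΦdef
  have hswap : ∀ W : DblConfig d G, Φ (W.swapOn L) = -Φ W := by
    intro W
    simp only [hΦdef, dblWeightProd]
    rw [DblConfig.apply_fst_swapOn_of_subset L hF₁ (S.subset_joinedRegion Q B₁),
      DblConfig.apply_snd_swapOn_of_subset L hF₁ (S.subset_joinedRegion Q B₁),
      DblConfig.apply_fst_swapOn_of_disjoint L hF₂ (S.disjoint_joinedRegion hJ hB),
      DblConfig.apply_snd_swapOn_of_disjoint L hF₂ (S.disjoint_joinedRegion hJ hB),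
      Finset.prod_congr rfl fun p hp => ?_]
    · ring
    · rcases S.bonds_subset_or_disjoint_joinedRegion Q B₁ hp with h1 | h1
      · exact S.dblWeight_swapOn_of_subset L β h1 W
      · exact S.dblWeight_swapOn_of_disjoint L β h1 W
  have hint := integral_comp_swapOnC L (Φ := Φ) hΦ
  simp_rw [hswap, integral_neg] at hint
  change ∫ W, Φ W ∂dblHaar d G = 0
  have h2 : (2 : ℂ) * ∫ W, Φ W ∂dblHaar d G = 0 := by rw [two_mul]; nth_rw 1 [← hint]; ring
  exact (mul_eq_zero.1 h2).resolve_left two_ne_zero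

end Join

end PlaqSystem

end

end Literature.MathematicalPhysics.QuantumFieldTheory
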